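import Mathlib.Algebra.Polynomial.BigOperators
import Mathlib.Analysis.Complex.Polynomial.GaussLucas
import Mathlib.RingTheory.MvPolynomial.Symmetric.Defs
import Mathlib.RingTheory.Polynomial.Vieta
import Literature.Combinatorics.StablePolynomials.Basic
import HarnessLib

/-!
# The elementary symmetric polynomials are stable

`e_N(z) = ∑_{|S| = N} ∏_{i ∈ S} zᵢ` (Mathlib's `MvPolynomial.esymm σ ℂ N`) has no zero in the
product of open upper half-planes `H^σ`, for `N ≤ |σ|` (Borcea–Brändén, Invent. Math. 177 (2009),
§2.2 with Prop. 2.4: `E_N` is the polarisation of the stable `z^N`; Choe–Oxley–Sokal–Wagner 2004,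
uniform matroids have the half-plane property). `Basic.lean` has the two extreme cases
`e₁ = ∑ zᵢ`, `e_n = ∏ zᵢ`; here the general case, by an argument that needs no limits:
`e_N(z)` is the coefficient of `t^{n-N}` in `g(t) = ∏ᵢ (t + zᵢ)` (Vieta,
`Multiset.prod_X_add_C_coeff'`), i.e. `g^{(n-N)}(0) / (n-N)!`; the zeros `-zᵢ` of `g` lie in the
open lower half-plane, hence by the **iterated Gauss–Lucas theorem**
(`rootSet_iterate_derivative_subset`, from Mathlib's
`Polynomial.rootSet_derivative_subset_convexHull_rootSet`) so do those of `g^{(n-N)}`, and `0` is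
not one of them.

## References

* J. Borcea, P. Brändén, *The Lee–Yang and Pólya–Schur programs. I*, Invent. Math. 177 (2009),
  §2.2, Prop. 2.4. [BorceaBranden2009]
* D. G. Wagner, *Multivariate stable polynomials: theory and applications*, Bull. AMS 48 (2011),
  §2 (Gauss–Lucas remark after Lemma 2.4). [Wagner2011]
-/

noncomputable section

open scoped BigOperators
open MvPolynomial

namespace Literature.Combinatorics.StablePolynomials

variable {σ : Type*}

/-- Exact degree of iterated derivatives in characteristic zero. [folklore] -/
theorem natDegree_iterate_derivative_eq (g : Polynomial ℂ) (j : ℕ) :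
    (Polynomial.derivative^[j] g).natDegree = g.natDegree - j := by
  induction j with
  | zero => simp
  | succ j ih =>
    rw [Function.iterate_succ_apply', Polynomial.natDegree_derivative, ih, Nat.sub_sub]

/-- **Iterated Gauss–Lucas**: if the zeros of `g` lie in a convex set `T`, so do the zeros of
`g^{(j)}` for `j < deg g` (and `g^{(j)} ≠ 0`). From Mathlib's Gauss–Lucas theorem
`Polynomial.rootSet_derivative_subset_convexHull_rootSet`. [folklore] -/
theorem rootSet_iterate_derivative_subset {g : Polynomial ℂ} {T : Set ℂ} (hT : Convex ℝ T)
    (hg : g.rootSet ℂ ⊆ T) {j : ℕ} (hj : j < g.natDegree) :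
    Polynomial.derivative^[j] g ≠ 0 ∧ (Polynomial.derivative^[j] g).rootSet ℂ ⊆ T := by
  induction j with
  | zero =>
    refine ⟨fun h => ?_, by simpa using hg⟩
    rw [Function.iterate_zero_apply] at h
    simp [h] at hj
  | succ j ih =>
    obtain ⟨_, hsub⟩ := ih (Nat.lt_of_succ_lt hj)
    have hdeg : 0 < (Polynomial.derivative^[j] g).natDegree := by
      rw [natDegree_iterate_derivative_eq]; omega
    refine ⟨fun h => ?_, ?_⟩
    · have := natDegree_iterate_derivative_eq g (j + 1)
      rw [h, Polynomial.natDegree_zero] at this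
      omega
    · rw [Function.iterate_succ_apply']
      exact (Polynomial.rootSet_derivative_subset_convexHull_rootSet
        (Polynomial.natDegree_pos_iff_degree_pos.1 hdeg)).trans (convexHull_min hsub hT)

/-- **The elementary symmetric polynomials are stable**: `e_N(z) = ∑_{|S| = N} ∏_{i ∈ S} zᵢ` has
no zero in `H^σ` for `N ≤ |σ|` (for `N > |σ|` it is the zero polynomial). Proof: `e_N(z)` is the
coefficient of `t^{n-N}` in `g(t) = ∏ᵢ (t + zᵢ)`, i.e. `g^{(n-N)}(0)/(n-N)!`; the zeros `-zᵢ` of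
`g` lie in the open lower half-plane, hence (iterated Gauss–Lucas) so do those of `g^{(n-N)}`,
and `0` is not among them. (Borcea–Brändén 2009, §2.2: the polarisation `E_k` of `z^k`;
Choe–Oxley–Sokal–Wagner.) [cite: BorceaBranden2009, Prop. 2.4 (with f = z^N, n = |σ|)] -/
theorem isUpperHalfPlaneStable_esymm [Fintype σ] {N : ℕ} (hN : N ≤ Fintype.card σ) :
    IsUpperHalfPlaneStable (MvPolynomial.esymm σ ℂ N) := by
  classical
  rcases Nat.eq_zero_or_pos N with rfl | hN1
  · intro z _
    simp [MvPolynomial.esymm_zero]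
  intro z hz h0
  set n := Fintype.card σ with hn
  let g : Polynomial ℂ := (Finset.univ.val.map fun i => Polynomial.X + Polynomial.C (z i)).prod
  have hg_eq : g = ((Finset.univ.val.map fun i => -z i).map
      fun a => Polynomial.X - Polynomial.C a).prod := by
    simp only [g, Multiset.map_map, Function.comp_def, map_neg, sub_neg_eq_add]
  have hcard : Multiset.card (Finset.univ : Finset σ).val = n := by
    rw [Finset.card_val, Finset.card_univ]
  have hg_deg : g.natDegree = n := by
    rw [hg_eq, Polynomial.natDegree_multiset_prod_X_sub_C_eq_card, Multiset.card_map, hcard]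
  have hg_roots : g.rootSet ℂ ⊆ {w : ℂ | w.im < 0} := by
    intro w hw
    rw [Polynomial.mem_rootSet] at hw
    have hw' : w ∈ g.roots := by
      rw [Polynomial.mem_roots hw.1]
      simpa using hw.2
    rw [hg_eq, Polynomial.roots_multiset_prod_X_sub_C, Multiset.mem_map] at hw'
    obtain ⟨i, _, rfl⟩ := hw'
    simpa using hz i
  have hconv : Convex ℝ {w : ℂ | w.im < 0} :=
    convex_halfSpace_lt ⟨fun _ _ => Complex.add_im _ _, fun c x => Complex.smul_im c x⟩ 0
  -- the coefficient of `t^{n-N}` in `g` is `e_N(z)`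
  have hcoeff : g.coeff (n - N) = eval z (MvPolynomial.esymm σ ℂ N) := by
    have h1 := Multiset.prod_X_add_C_coeff' (Finset.univ : Finset σ).val z (k := n - N)
      (by rw [hcard]; exact Nat.sub_le n N)
    simp only [g]
    rw [h1, hcard, Nat.sub_sub_self hN]
    exact (MvPolynomial.aeval_esymm_eq_multiset_esymm σ ℂ N z).symm
  obtain ⟨hne, hsub⟩ := rootSet_iterate_derivative_subset hconv hg_roots (j := n - N)
    (by rw [hg_deg]; omega)
  have hroot : (0 : ℂ) ∈ (Polynomial.derivative^[n - N] g).rootSet ℂ := by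
    rw [Polynomial.mem_rootSet]
    refine ⟨hne, ?_⟩
    rw [Polynomial.coe_aeval_eq_eval, ← Polynomial.coeff_zero_eq_eval_zero,
      Polynomial.coeff_iterate_derivative, zero_add, hcoeff, h0, smul_zero]
  have := hsub hroot
  simp at this

/-- Real-coefficient form: `e_N` is real stable for `N ≤ |σ|`. [cite: BorceaBranden2009, Prop. 2.4] -/
theorem isRealStable_esymm [Fintype σ] {N : ℕ} (hN : N ≤ Fintype.card σ) :
    IsRealStable (MvPolynomial.esymm σ ℝ N) := by
  unfold IsRealStable
  rw [MvPolynomial.map_esymm]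
  exact isUpperHalfPlaneStable_esymm hN

end Literature.Combinatorics.StablePolynomials

end
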